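import Literature.AnabelianGeometry.SemiGraphs.TemperedOpenMapping
import Literature.AnabelianGeometry.SemiGraphs.TemperedCompletionOpenSubgroups
import Literature.AnabelianGeometry.EtaleTheta.SettingCompletion
import Literature.AnabelianGeometry.SemiGraphs.TemperedCurveGaloisInfinite
import HarnessLib

/-!
# [SemiAnbd] §6: `Δ_X` IS the profinite completion of `Δ^temp_X`, and `1 → Δ_X → Π_X → G_K` is exact

Mochizuki, *Semi-graphs of anabelioids*, Publ. RIMS **42** (2006) [SemiAnbd], §6, author's manuscript
p. 69: "we shall write `Π_{X_K} := (Π^temp_{X_K})^∧`; `Δ_X := (Δ^temp_X)^∧`" [the `∧` denoting the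
profinite completion], together with the natural exact sequence
`1 → Δ^temp_X → Π^temp_{X_K} → G_K → 1` of TOPOLOGICAL groups; and p. 73 (proof of Thm. 6.6):
"the `∧` denotes profinite completion, or, EQUIVALENTLY, closure in `Π_{X_K}`".
[cite: MochizukiSemiAnbd2006, §6 p.69, p.73]

The curve-level interface `TemperedCurve p` (`TemperedAnabelian.lean`, abc-iut-L3-t4) DEFINES
`X.DeltaHat := closure of ι(Δ^temp_X) in Π_X` and the map `X.deltaToHat : Δ^temp_X → Δ_X`.  Two
statements about these objects are carried elsewhere in the tree as HYPOTHESES / PARAMETER FIELDS: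

* `IsProfiniteCompletion X.deltaToHat` — "not an interface axiom" (hypothesis `hΔ` of
  `TemperedCurve.deltaTempDFGIffDOF_of_virtuallyFreeQuotients`, abc-iut-w5-d240; needed by every
  `Δ^temp`-half of [SemiAnbd] Lem. 6.1 (ii) / 6.3 (ii)(iii));
* `X.augHat.toMonoidHom.ker = X.DeltaHat` — exactness of the completed sequence, the parameter
  field (P1) `ker_augHat` of `EtaleTheta.ThetaSetting.OncePuncturedData` (which EXTENDS
  `TemperedCurve.GroupLevelData`); `EtaleTheta/SettingCompletion.lean` proves `⊇`
  (`deltaHat_le_ker_augHat`) and records "`⊆` is not forced by `IsProfiniteCompletion`".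

This PROOF-ONLY file (abc-iut cell, prover abc-iut-w5-d139; no definitions, no named facts) proves
BOTH from the interface axioms plus the printed properties "`Π^temp` tempered" (`IsTempered X.PiTemp`)
and "Galois-countable" (first countability of `Π^temp` suffices) alone — equivalently from the standard
parameter bundle `d : X.GroupLevelData` of ruling η′ — so the printed "equivalently" of p. 73 and the
exactness of p. 69 are THEOREMS for every tempered, Galois-countable `X`:

* `TemperedCurve.ker_augHat_eq_deltaHat_of_isTempered (hT) [FirstCountableTopology X.PiTemp]` and
  `TemperedCurve.ker_augHat_eq_deltaHat (d) : X.augHat.toMonoidHom.ker = X.DeltaHat`;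
* `TemperedCurve.isProfiniteCompletion_deltaToHat_of_isTempered (hT) [FirstCountableTopology X.PiTemp]`
  and `TemperedCurve.isProfiniteCompletion_deltaToHat (d) : IsProfiniteCompletion X.deltaToHat`.

The `Δ^temp_X`-halves of [SemiAnbd] Lem. 6.1 (ii) / 6.3 (ii)(iii) that consume these two theorems
(discharging the `hΔ` hypotheses) are in the companion file `TemperedDeltaNormalizers.lean`.

Mechanism (classical): by the tree's open-mapping theorem for tempered groups
(`TemperedCurve.isOpenMap_aug_of_isTempered`, `TemperedOpenMapping.lean`) the augmentation
`Π^temp_{X_K} → G_K` is OPEN, so every open normal `N ⊴ Π^temp` has open image of FINITE index in the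
compact group `G_K`; hence for an open normal `U ⊴ Δ^temp_X` of finite index (which contains
`N ∩ Δ^temp` for some such `N`, temperedness) the subgroup `U·N ≤ Π^temp` is open OF FINITE INDEX,
and the completion axiom `IsProfiniteCompletion.comap_surjective` for `Π^temp ↪ Π_X` produces the
open normal subgroup of `Δ_X` cutting out `U`.  Exactness: for `x ∈ Ker(augHat)` and an open normal
`V ⊴ Π_X`, density gives `ι g ∈ xV`; then `aug g ∈ augHat(V) ⊆ closure aug(ι⁻¹V) = aug(ι⁻¹V)`
(open image, hence closed), so `g` may be corrected inside `ι⁻¹V` into `Δ^temp_X`.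
Nothing here concerns the disputed parts of inter-universal Teichmüller theory or takes a side on
[IUTchIII] Cor. 3.12; typed ≠ proved for the §6 theorems themselves.
-/

noncomputable section

namespace Literature.AnabelianGeometry.SemiGraphs

namespace TemperedCurve

open Topology
open scoped Pointwise

variable {p : ℕ} [Fact p.Prime] (X : TemperedCurve p)

/-! ### Preliminaries on the augmentation -/

/-- Membership in `Δ^temp_X = Ker(aug)`. [cite: MochizukiSemiAnbd2006, §6 p.69] -/
private theorem mem_deltaTemp_iff (g : X.PiTemp) : g ∈ X.DeltaTemp ↔ X.aug g = 1 := Iff.rfl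

/-- The kernel of the range-restricted augmentation `augGK : Π^temp ↠ G_K` is `Δ^temp_X`.
[cite: MochizukiSemiAnbd2006, §6 p.69] -/
private theorem ker_augGK : X.augGK.toMonoidHom.ker = X.DeltaTemp := by
  ext g
  rw [MonoidHom.mem_ker, mem_deltaTemp_iff]
  change X.augGK g = 1 ↔ X.aug g = 1
  rw [Subtype.ext_iff, coe_augGK_apply]
  rfl

/-- Under the parameter bundle (`Π^temp` tempered and Galois-countable), the image in `G_K` of an open
normal subgroup of `Π^temp_{X_K}` is (open, hence) of finite index: the augmentation is an open map
onto the compact group `G_K`. [cite: MochizukiSemiAnbd2006, §6 p.69] -/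
private theorem finiteIndex_map_augGK (hT : IsTempered X.PiTemp) [FirstCountableTopology X.PiTemp]
    (N : OpenNormalSubgroup X.PiTemp) :
    (N.toSubgroup.map X.augGK.toMonoidHom).FiniteIndex := by
  haveI := X.compactSpace_GK
  have hopen : IsOpen ((N.toSubgroup.map X.augGK.toMonoidHom : Subgroup X.GK) : Set X.GK) := by
    rw [Subgroup.coe_map]
    exact X.isOpenMap_augGK_of_isTempered hT _ N.toOpenSubgroup.isOpen
  haveI : Finite (X.GK ⧸ (N.toSubgroup.map X.augGK.toMonoidHom)) :=
    Subgroup.quotient_finite_of_isOpen _ hopen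
  exact Subgroup.finiteIndex_of_finite_quotient

/-- Hence `Δ^temp_X · N` has finite index in `Π^temp_{X_K}` for every open normal `N`.
[cite: MochizukiSemiAnbd2006, §6 p.69] -/
private theorem finiteIndex_deltaTemp_sup (hT : IsTempered X.PiTemp)
    [FirstCountableTopology X.PiTemp] (N : OpenNormalSubgroup X.PiTemp) :
    (X.DeltaTemp ⊔ N.toSubgroup).FiniteIndex := by
  haveI := X.finiteIndex_map_augGK hT N
  have h : X.DeltaTemp ⊔ N.toSubgroup =
      (N.toSubgroup.map X.augGK.toMonoidHom).comap X.augGK.toMonoidHom := by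
    rw [Subgroup.comap_map_eq, ker_augGK, sup_comm]
  rw [h]
  refine ⟨?_⟩
  rw [Subgroup.index_comap_of_surjective _ X.augGK_surjective]
  exact Subgroup.FiniteIndex.index_ne_zero

/-! ### Exactness of the completed sequence: `Ker(Π_X → G_{ℚ_p}) = Δ_X` -/

/-- **Exactness of `1 → Δ_X → Π_X → G_K`** ([SemiAnbd] §6 p. 69: "`Δ_X := (Δ^temp_X)^∧`" inside
"`Π_{X_K} := (Π^temp_{X_K})^∧`", completing "`1 → Δ^temp_X → Π^temp_{X_K} → G_K → 1`"): for a
tempered, Galois-countable `X` (parameter bundle `d : X.GroupLevelData`), the kernel of the profinite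
augmentation `augHat : Π_X → G_{ℚ_p}` IS `Δ_X` (= the closure of `ι(Δ^temp_X)`); here in the form
over the printed hypotheses "`Π^temp` tempered" (`IsTempered`) and "Galois-countable" (first countability
suffices).  The inclusion `⊇`
is `EtaleTheta.SettingCompletion.deltaHat_le_ker_augHat`; for `⊆`, given `x ∈ Ker(augHat)` and an open
normal `V ⊴ Π_X`, density of `ι(Π^temp)` gives `ι g ∈ xV`, so `aug g = augHat(x⁻¹ ι g) ∈ augHat(V)`,
which lies in the closure of `aug(ι⁻¹V)` — an OPEN (open-mapping theorem,
`isOpenMap_aug_of_isTempered`), hence closed, subgroup — so `aug g = aug n` with `ι n ∈ V` and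
`ι(g n⁻¹) ∈ ι(Δ^temp_X) ∩ xV`. [cite: MochizukiSemiAnbd2006, §6 p.69] -/
theorem ker_augHat_eq_deltaHat_of_isTempered (hT : IsTempered X.PiTemp)
    [FirstCountableTopology X.PiTemp] : X.augHat.toMonoidHom.ker = X.DeltaHat := by
  refine le_antisymm ?_ (EtaleTheta.SettingCompletion.deltaHat_le_ker_augHat X)
  intro x hx
  have hι := X.isProfiniteCompletion_toHat
  haveI : CompactSpace X.PiHat := hι.compactSpace
  haveI : TotallyDisconnectedSpace X.PiHat := hι.totallyDisconnectedSpace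
  have hopen : IsOpenMap X.aug := X.isOpenMap_aug_of_isTempered hT
  have hx1 : X.augHat x = 1 := hx
  have hcl : x ∈ closure (((X.DeltaTemp.map X.toHat.toMonoidHom : Subgroup X.PiHat)) : Set X.PiHat) := by
    rw [mem_closure_iff]
    intro O hO hxO
    -- an open normal subgroup `V ⊴ Π_X` with `xV ⊆ O`
    have h1O : (1 : X.PiHat) ∈ (fun y => x * y) ⁻¹' O := by simpa using hxO
    obtain ⟨V, hV⟩ := ProfiniteGrp.exist_openNormalSubgroup_sub_open_nhds_of_one
      (hO.preimage (by fun_prop : Continuous fun y : X.PiHat => x * y)) h1O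
    -- density of `ι(Π^temp)`: some `ι g ∈ xV`
    have hxVopen : IsOpen ((fun y => x * y) '' (V : Set X.PiHat)) :=
      (Homeomorph.mulLeft x).isOpenMap _ V.toOpenSubgroup.isOpen
    obtain ⟨g, hg⟩ := hι.denseRange.exists_mem_open hxVopen
      ⟨x, ⟨1, V.toSubgroup.one_mem, mul_one x⟩⟩
    obtain ⟨v, hv, hgv⟩ := hg
    -- `N := ι⁻¹(V)`, an open subgroup of `Π^temp`
    set N : Subgroup X.PiTemp := V.toSubgroup.comap X.toHat.toMonoidHom with hN
    have haug_g : X.aug g = X.augHat v := by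
      rw [← X.augHat_comp g, ← hgv, map_mul, hx1, one_mul]
    -- `augHat(V) ⊆ closure (aug(N)) = aug(N)`
    have hVcl : (V : Set X.PiHat) ⊆ closure ((V : Set X.PiHat) ∩ Set.range X.toHat) :=
      hι.denseRange.open_subset_closure_inter V.toOpenSubgroup.isOpen
    have himage : X.augHat '' ((V : Set X.PiHat) ∩ Set.range X.toHat) ⊆
        X.aug '' (N : Set X.PiTemp) := by
      rintro _ ⟨w, ⟨hwV, ⟨n, rfl⟩⟩, rfl⟩
      exact ⟨n, hwV, (X.augHat_comp n).symm⟩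
    have hclosedN : IsClosed (X.aug '' (N : Set X.PiTemp)) := by
      have hopenN : IsOpen (X.aug '' (N : Set X.PiTemp)) := hopen _ (hι.isOpen_comap V)
      have e : X.aug '' (N : Set X.PiTemp) =
          ((N.map X.aug.toMonoidHom : Subgroup (GQp p)) : Set (GQp p)) := (Subgroup.coe_map _ _).symm
      rw [e] at hopenN ⊢
      exact Subgroup.isClosed_of_isOpen _ hopenN
    have hmem : X.augHat v ∈ X.aug '' (N : Set X.PiTemp) := by
      have h1 : X.augHat v ∈ closure (X.augHat '' ((V : Set X.PiHat) ∩ Set.range X.toHat)) :=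
        image_closure_subset_closure_image X.augHat.continuous ⟨v, hVcl hv, rfl⟩
      rw [← hclosedN.closure_eq]
      exact closure_mono himage h1
    obtain ⟨n, hn, hng⟩ := hmem
    -- the corrected element `g n⁻¹ ∈ Δ^temp_X` with `ι(g n⁻¹) ∈ xV ⊆ O`
    refine ⟨X.toHat (g * n⁻¹), ?_, ⟨g * n⁻¹, ?_, rfl⟩⟩
    · have e : X.toHat (g * n⁻¹) = x * (v * (X.toHat n)⁻¹) := by
        rw [map_mul, map_inv, ← hgv, mul_assoc]
      rw [e]
      exact hV (V.toSubgroup.mul_mem hv (V.toSubgroup.inv_mem hn))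
    · change X.aug (g * n⁻¹) = 1
      rw [map_mul, map_inv, haug_g, ← hng, mul_inv_cancel]
  change x ∈ (X.DeltaTemp.map X.toHat.toMonoidHom).topologicalClosure
  rw [← SetLike.mem_coe, Subgroup.topologicalClosure_coe]
  exact hcl

/-- **Exactness of `1 → Δ_X → Π_X → G_K`** under the parameter bundle `d : X.GroupLevelData` of ruling
η′ ("`Π^temp` tempered", "Galois-countable"): `Ker(augHat) = Δ_X`.  This is the form that discharges the
parameter field (P1) `ker_augHat` of `EtaleTheta.ThetaSetting.OncePuncturedData` (which extends
`GroupLevelData`). [cite: MochizukiSemiAnbd2006, §6 p.69] -/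
theorem ker_augHat_eq_deltaHat (d : X.GroupLevelData) : X.augHat.toMonoidHom.ker = X.DeltaHat := by
  haveI := d.secondCountableTopology
  exact X.ker_augHat_eq_deltaHat_of_isTempered d.isTempered

/-! ### `Δ^temp_X ↪ Δ_X` is a profinite completion -/

/-- `ι(Δ^temp_X)` is dense in its closure `Δ_X`: the map `deltaToHat` has dense range.
[cite: MochizukiSemiAnbd2006, §6 p.69] -/
theorem denseRange_deltaToHat : DenseRange X.deltaToHat := by
  rw [DenseRange, Subtype.dense_iff]
  intro y hy
  have hy' : y ∈ closure (((X.DeltaTemp.map X.toHat.toMonoidHom : Subgroup X.PiHat)) :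
      Set X.PiHat) := by
    rw [← Subgroup.topologicalClosure_coe]
    exact hy
  refine closure_mono ?_ hy'
  rintro _ ⟨g, hg, rfl⟩
  exact ⟨X.deltaToHat ⟨g, hg⟩, ⟨_, rfl⟩, rfl⟩

/-- **The completion axiom for `Δ^temp_X ↪ Δ_X`**: every open normal subgroup `U ⊴ Δ^temp_X` of
finite index is cut out by an open normal subgroup of `Δ_X` ([SemiAnbd] p. 73: "profinite
completion, or, equivalently, closure in `Π_{X_K}`").  Proof: `U ⊇ N ∩ Δ^temp_X` for an open
normal `N ⊴ Π^temp_{X_K}` (temperedness); `U·N ≤ Π^temp` is open OF FINITE INDEX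
(`finiteIndex_deltaTemp_sup` + `[Δ^temp : U] < ∞`) with `U·N ∩ Δ^temp_X = U`; the completion axiom
for `Π^temp ↪ Π_X` gives an open normal `V' ⊴ Π_X` with `ι⁻¹(V') ≤ U·N`, and
`V := (ι(U)·V') ∩ Δ_X` is an open normal subgroup of `Δ_X` (normality by density of `ι(Δ^temp_X)`)
with `ι⁻¹(V) ∩ Δ^temp_X = U`. [cite: MochizukiSemiAnbd2006, §6 p.73] -/
theorem exists_openNormal_comap_deltaToHat_eq_of_isTempered (hT : IsTempered X.PiTemp)
    [FirstCountableTopology X.PiTemp]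
    (U : OpenNormalSubgroup X.DeltaTemp) (hU : U.toSubgroup.FiniteIndex) :
    ∃ V : OpenNormalSubgroup X.DeltaHat,
      U.toSubgroup = V.toSubgroup.comap X.deltaToHat.toMonoidHom := by
  classical
  have hι := X.isProfiniteCompletion_toHat
  haveI : CompactSpace X.PiHat := hι.compactSpace
  -- Step 1: an open normal `N ⊴ Π^temp` with `N ∩ Δ^temp ⊆ U`
  have hU1 : ((U.toOpenSubgroup : OpenSubgroup X.DeltaTemp) : Set X.DeltaTemp) ∈
      𝓝 (1 : X.DeltaTemp) := U.toOpenSubgroup.mem_nhds_one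
  obtain ⟨O, hO, hOU⟩ := (mem_nhds_subtype _ _ _).1 hU1
  obtain ⟨N, -, hNO⟩ := hT.basis O (by simpa using hO)
  have hNU : ∀ g : X.DeltaTemp, (g : X.PiTemp) ∈ N → g ∈ U := fun g hg => hOU (hNO hg)
  -- Step 2: `U₀ := U ≤ Π^temp` and `U' := U₀ ⊔ N`
  set U₀ : Subgroup X.PiTemp := U.toSubgroup.map X.DeltaTemp.subtype with hU₀
  have hU₀le : U₀ ≤ X.DeltaTemp := fun g ⟨u, _, hu⟩ => hu ▸ u.2
  set U' : Subgroup X.PiTemp := U₀ ⊔ N.toSubgroup with hU'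
  have hNU' : N.toSubgroup ≤ U' := le_sup_right
  have hU'open : IsOpen (U' : Set X.PiTemp) := Subgroup.isOpen_mono hNU' N.toOpenSubgroup.isOpen
  -- `U' ∩ Δ^temp ⊆ U₀`
  have hU'Δ : ∀ g ∈ U', g ∈ X.DeltaTemp → g ∈ U₀ := by
    intro g hg hgΔ
    have hg' : g ∈ ((U₀ ⊔ N.toSubgroup : Subgroup X.PiTemp) : Set X.PiTemp) := hg
    rw [Subgroup.mul_normal] at hg'
    obtain ⟨u, hu, n, hn, rfl⟩ := Set.mem_mul.1 hg'
    have hnΔ : n ∈ X.DeltaTemp := by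
      have := X.DeltaTemp.mul_mem (X.DeltaTemp.inv_mem (hU₀le hu)) hgΔ
      simpa using this
    have hnU : (⟨n, hnΔ⟩ : X.DeltaTemp) ∈ U := hNU ⟨n, hnΔ⟩ hn
    exact U₀.mul_mem hu ⟨⟨n, hnΔ⟩, hnU, rfl⟩
  -- `U'` has finite index in `Π^temp`
  haveI hU'fi : U'.FiniteIndex := by
    let π := QuotientGroup.mk' N.toSubgroup
    have hπ : Function.Surjective π := QuotientGroup.mk'_surjective _
    have hU'eq : U' = (U₀.map π).comap π := by
      rw [Subgroup.comap_map_eq, QuotientGroup.ker_mk']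
    haveI hΔN : (X.DeltaTemp ⊔ N.toSubgroup).FiniteIndex := X.finiteIndex_deltaTemp_sup hT N
    have hΔbar : (X.DeltaTemp.map π).index ≠ 0 := by
      rw [← Subgroup.index_comap_of_surjective _ hπ, Subgroup.comap_map_eq, QuotientGroup.ker_mk']
      exact hΔN.index_ne_zero
    have hle : U₀.map π ≤ X.DeltaTemp.map π := Subgroup.map_mono hU₀le
    have hrel : (U₀.map π).relIndex (X.DeltaTemp.map π) ≠ 0 := by
      let φ := π.subgroupMap X.DeltaTemp
      have hφ : Function.Surjective φ := π.subgroupMap_surjective X.DeltaTemp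
      have hsub : U.toSubgroup.map φ ≤ (U₀.map π).subgroupOf (X.DeltaTemp.map π) := by
        rintro _ ⟨u, hu, rfl⟩
        rw [Subgroup.mem_subgroupOf]
        exact ⟨(u : X.PiTemp), ⟨u, hu, rfl⟩, rfl⟩
      have h1 : (U.toSubgroup.map φ).index ≠ 0 :=
        ne_zero_of_dvd_ne_zero hU.index_ne_zero (U.toSubgroup.index_map_dvd hφ)
      exact ne_zero_of_dvd_ne_zero h1 (Subgroup.index_dvd_of_le hsub)
    rw [hU'eq]
    refine ⟨?_⟩
    rw [Subgroup.index_comap_of_surjective _ hπ, ← Subgroup.relIndex_mul_index hle]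
    exact mul_ne_zero hrel hΔbar
  -- Step 3: an open normal `V' ⊴ Π_X` with `ι⁻¹(V') ≤ U'`
  obtain ⟨V', hV'U', -⟩ := IsProfiniteCompletion.exists_openNormal_le hι U' hU'open
  -- Step 4: `W := ι(U₀)·V'`, an open subgroup of `Π_X` normalised by `Δ_X`
  set W : Subgroup X.PiHat := U₀.map X.toHat.toMonoidHom ⊔ V'.toSubgroup with hW
  have hV'W : V'.toSubgroup ≤ W := le_sup_right
  have hWopen : IsOpen (W : Set X.PiHat) := Subgroup.isOpen_mono hV'W V'.toOpenSubgroup.isOpen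
  have hWclosed : IsClosed (W : Set X.PiHat) := Subgroup.isClosed_of_isOpen _ hWopen
  have hconj : ∀ x ∈ X.DeltaHat, ∀ w ∈ W, x * w * x⁻¹ ∈ W := by
    intro x hx
    have hT : IsClosed {y : X.PiHat | ∀ w ∈ W, y * w * y⁻¹ ∈ W} := by
      have e : {y : X.PiHat | ∀ w ∈ W, y * w * y⁻¹ ∈ W} =
          ⋂ w ∈ W, (fun y : X.PiHat => y * w * y⁻¹) ⁻¹' (W : Set X.PiHat) := by
        ext y
        simp only [Set.mem_setOf_eq, Set.mem_iInter, Set.mem_preimage, SetLike.mem_coe]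
      rw [e]
      exact isClosed_biInter fun w _ => hWclosed.preimage (by fun_prop)
    have hsub : ((X.DeltaTemp.map X.toHat.toMonoidHom : Subgroup X.PiHat) : Set X.PiHat) ⊆
        {y : X.PiHat | ∀ w ∈ W, y * w * y⁻¹ ∈ W} := by
      rintro _ ⟨δ, hδ, rfl⟩ w hw
      have hw' : w ∈ ((U₀.map X.toHat.toMonoidHom ⊔ V'.toSubgroup : Subgroup X.PiHat) :
          Set X.PiHat) := hw
      rw [Subgroup.mul_normal] at hw'
      obtain ⟨_, ⟨u, hu, rfl⟩, v, hv, rfl⟩ := Set.mem_mul.1 hw'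
      obtain ⟨u', hu', rfl⟩ := hu
      change X.toHat δ * (X.toHat (u' : X.PiTemp) * v) * (X.toHat δ)⁻¹ ∈ W
      have e : X.toHat δ * (X.toHat (u' : X.PiTemp) * v) * (X.toHat δ)⁻¹ =
          X.toHat (δ * u' * δ⁻¹) * (X.toHat δ * v * (X.toHat δ)⁻¹) := by
        simp only [map_mul, map_inv]
        group
      rw [e]
      refine W.mul_mem (Subgroup.mem_sup_left ⟨δ * u' * δ⁻¹, ?_, rfl⟩)
        (Subgroup.mem_sup_right ((inferInstance : V'.toSubgroup.Normal).conj_mem v hv _))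
      exact ⟨⟨δ, hδ⟩ * u' * ⟨δ, hδ⟩⁻¹,
        (inferInstance : U.toSubgroup.Normal).conj_mem u' hu' ⟨δ, hδ⟩, rfl⟩
    have hx' : x ∈ closure (((X.DeltaTemp.map X.toHat.toMonoidHom : Subgroup X.PiHat)) :
        Set X.PiHat) := by
      rw [← Subgroup.topologicalClosure_coe]
      exact hx
    exact hT.closure_subset_iff.2 hsub hx'
  let V : OpenNormalSubgroup X.DeltaHat :=
    { toOpenSubgroup := ⟨W.comap X.DeltaHat.subtype, hWopen.preimage continuous_subtype_val⟩
      isNormal' := ⟨fun n hn g => hconj (g : X.PiHat) g.2 (n : X.PiHat) hn⟩ }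
  -- Step 5: `ι⁻¹(V) ∩ Δ^temp = U`
  refine ⟨V, le_antisymm ?_ ?_⟩
  · intro u hu
    change X.toHat (u : X.PiTemp) ∈ W
    exact Subgroup.mem_sup_left ⟨(u : X.PiTemp), ⟨u, hu, rfl⟩, rfl⟩
  · intro g hg
    change X.toHat (g : X.PiTemp) ∈ W at hg
    have hg' : X.toHat (g : X.PiTemp) ∈
        ((U₀.map X.toHat.toMonoidHom ⊔ V'.toSubgroup : Subgroup X.PiHat) : Set X.PiHat) := hg
    rw [Subgroup.mul_normal] at hg'
    obtain ⟨_, ⟨u, hu, rfl⟩, v, hv, hav⟩ := Set.mem_mul.1 hg'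
    have hv' : X.toHat (u⁻¹ * (g : X.PiTemp)) ∈ V'.toSubgroup := by
      have e : v = (X.toHat u)⁻¹ * X.toHat (g : X.PiTemp) := by
        rw [← hav]
        change v = (X.toHat u)⁻¹ * (X.toHat u * v)
        rw [inv_mul_cancel_left]
      rw [map_mul, map_inv, ← e]
      exact hv
    have h1 : u⁻¹ * (g : X.PiTemp) ∈ U' := hV'U' hv'
    have h2 : u⁻¹ * (g : X.PiTemp) ∈ X.DeltaTemp :=
      X.DeltaTemp.mul_mem (X.DeltaTemp.inv_mem (hU₀le hu)) g.2
    have h3 : u⁻¹ * (g : X.PiTemp) ∈ U₀ := hU'Δ _ h1 h2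
    have h4 : (g : X.PiTemp) ∈ U₀ := by simpa using U₀.mul_mem hu h3
    obtain ⟨g', hg', hgg'⟩ := h4
    have e : g' = g := Subtype.ext hgg'
    rw [← e]
    exact hg'

/-- The completion axiom for `Δ^temp_X ↪ Δ_X` under the parameter bundle `d : X.GroupLevelData`
(ruling η′). [cite: MochizukiSemiAnbd2006, §6 p.73] -/
theorem exists_openNormal_comap_deltaToHat_eq (d : X.GroupLevelData)
    (U : OpenNormalSubgroup X.DeltaTemp) (hU : U.toSubgroup.FiniteIndex) :
    ∃ V : OpenNormalSubgroup X.DeltaHat,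
      U.toSubgroup = V.toSubgroup.comap X.deltaToHat.toMonoidHom := by
  haveI := d.secondCountableTopology
  exact X.exists_openNormal_comap_deltaToHat_eq_of_isTempered d.isTempered U hU

/-- **`Δ_X` is the profinite completion of `Δ^temp_X`** ([SemiAnbd] §6 p. 69 "`Δ_X := (Δ^temp_X)^∧`";
p. 73: "the `∧` denotes profinite completion, or, EQUIVALENTLY, closure in `Π_{X_K}`"): for `X` with
`Π^temp_{X_K}` tempered (`IsTempered`) and Galois-countable (first countable suffices), the interface map
`X.deltaToHat : Δ^temp_X → Δ_X` (into the CLOSURE of `ι(Δ^temp_X)` in `Π_X`, the tree's definition of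
`Δ_X`) satisfies `IsProfiniteCompletion`.  Compactness / Hausdorff / total disconnectedness are
inherited from `Π_X` by the closed subgroup `Δ_X`, density is by construction, and the completion
axiom is `exists_openNormal_comap_deltaToHat_eq_of_isTempered`. [cite: MochizukiSemiAnbd2006, §6 p.73] -/
theorem isProfiniteCompletion_deltaToHat_of_isTempered (hT : IsTempered X.PiTemp)
    [FirstCountableTopology X.PiTemp] : IsProfiniteCompletion X.deltaToHat := by
  have hι := X.isProfiniteCompletion_toHat
  haveI : CompactSpace X.PiHat := hι.compactSpace
  haveI : T2Space X.PiHat := hι.t2Space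
  haveI : TotallyDisconnectedSpace X.PiHat := hι.totallyDisconnectedSpace
  have hclosed : IsClosed (X.DeltaHat : Set X.PiHat) := Subgroup.isClosed_topologicalClosure _
  exact
    { compactSpace := isCompact_iff_compactSpace.1 hclosed.isCompact
      t2Space := inferInstance
      totallyDisconnectedSpace := inferInstance
      denseRange := X.denseRange_deltaToHat
      comap_surjective := fun U hU =>
        X.exists_openNormal_comap_deltaToHat_eq_of_isTempered hT U hU
      isOpen_comap := fun V => V.toOpenSubgroup.isOpen.preimage X.deltaToHat.continuous }

/-- **`Δ_X` is the profinite completion of `Δ^temp_X`** under the parameter bundle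
`d : X.GroupLevelData` of ruling η′ ("`Π^temp` tempered", "Galois-countable"): the form that discharges
the hypothesis `hΔ : IsProfiniteCompletion X.deltaToHat` of the `Δ^temp`-halves of [SemiAnbd] Lem. 6.1
(ii), 6.3 (ii)(iii). [cite: MochizukiSemiAnbd2006, §6 p.73] -/
theorem isProfiniteCompletion_deltaToHat (d : X.GroupLevelData) :
    IsProfiniteCompletion X.deltaToHat := by
  haveI := d.secondCountableTopology
  exact X.isProfiniteCompletion_deltaToHat_of_isTempered d.isTempered

end TemperedCurve

end Literature.AnabelianGeometry.SemiGraphs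

end
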